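import Mathlib
import Summits.ValiantsHypothesis.ValiantsHypothesis.Theorems.GrenetZeonPolySizeQPAlgebraResidualCorankTwoBlock
import HarnessLib

/-!
# Crux `GrenetZeon.PolySizeQPAlgebra` (stmt-ValiantsHypothesis-8064), line `vbp-slice-dealg` —
# the local Hessian bound at RESIDUAL CORANK TWO, for EVERY coefficient algebra

`…LocalReduction` / `…LocalReductionResidual` reduce every point `(n, s)` of the `c = 1` box to good
`(s+1)`-spaces and the type-independent input `LocalHessianBound n`:
`det A(p) = 0` in `R` ⟹ `rank Hess λ(det A)(p) ≤ 2 · dim R · n`.  The tree has it at residual corank one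
(`…ResidualCorankOne`: a unit `(n-1)`-minor of `A(p)`).  This file proves it at residual corank `≤ 2`:

* `rank_hess0_transl_le_of_isUnit_minor` — **for ANY finite-dimensional commutative `ℂ`-algebra `R`, any
  functional `λ`, any affine `A` with `det A(p) = 0` in `R` and a UNIT `(n-2) × (n-2)` minor of the value
  matrix `A(p)`: `rank Hess F(p) ≤ 2 · dim_ℂ R · n`** (`n = |ι|`, rows/columns of the minor given by maps
  `r, c : κ → ι`, `|ι| = |κ| + 2`).
* `rank_hess0_transl_le_of_residual_minor_ne_zero` — residual form through a character `φ` of nilpotent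
  kernel: some `(n-2)`-minor of `φ(A(p))` is non-zero, i.e. `A(p) mod 𝔪` has corank `≤ 2`.

Proof (memo of hand 6-g2, FACT 0/1/2, all typed): `exists_equiv_sum_fin_two` splits `ι ≃ κ ⊕ Fin 2` along
the rows and the columns of the minor; block Gaussian elimination over `R` (`blockNormalForm_eq`:
`P A(p) Q = diag(1_κ, S)`, `S = B₂₂ - B₂₁ B₁₁⁻¹ B₁₂ ∈ Mat₂(R)`, `det S = 0`) is by CONSTANT matrices, so it
transports the affine matrix (`A' = P A Q`, still affine), the read-out functional (`λ' = λ ∘ (u⁻¹ ·)`,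
`u = ± det P` a unit, `det_reindex_eq_sign_mul`) and leaves `F`, hence the Hessian, unchanged; at the normal
form `rank_hess0_transl_le_of_blockNormalForm` (`…ResidualCorankTwoBlock`: jet ring `R[η][ε]`, block
determinant, graph lemma, `AL(2)`) gives `2 · dim R · (|κ| + 2)`.

So of the input `LocalHessianBound n` exactly the points of residual corank `≥ 3` (all `(n-2)`-minors of
`A(p)` in `𝔪`) remain (`…LocalReductionResidualThree`).  HONEST FRAMING: a rank count; no stub of the line
is closed; VP ≠ VNP is not moved.

References: T. Mignon, N. Ressayre, IMRN 2004:79, §2 (the case `R = ℂ`) [MignonRessayre2004];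
P. Hrubeš, A. Yehudayoff, Theory of Computing 7 (2011), §2 (extension-ring accounting) [HrubesYehudayoff2011].
-/

noncomputable section

open MvPolynomial Matrix
open Literature.Computability.AlgebraicComplexity

-- single-conjunct layout `Summits/ValiantsHypothesis/ValiantsHypothesis`: duplicated namespace by design
set_option linter.dupNamespace false

namespace Summit.ValiantsHypothesis.ValiantsHypothesis.Theorems.GrenetZeonPolySizeQPAlgebra

/-! ### Index bookkeeping: an injection `κ → ι` missing two points splits `ι ≃ κ ⊕ Fin 2` -/

section Equiv

variable {ι κ : Type*} [Fintype ι] [Fintype κ] [DecidableEq ι]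

/-- An injection `r : κ → ι` whose image misses exactly two points extends to an equivalence
`ι ≃ κ ⊕ Fin 2` sending `r i` to `inl i`. [folklore] -/
theorem exists_equiv_sum_fin_two (r : κ → ι) (hr : Function.Injective r)
    (hcard : Fintype.card ι = Fintype.card κ + 2) :
    ∃ e : ι ≃ κ ⊕ Fin 2, ∀ i, e (r i) = Sum.inl i := by
  classical
  have hc : Fintype.card {x // x ∉ Set.range r} = 2 := by
    rw [Fintype.card_subtype_compl, Set.card_range_of_injective hr, hcard]
    simp
  let e₂ : {x // x ∉ Set.range r} ≃ Fin 2 := Fintype.equivFinOfCardEq hc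
  let e₁ : {x // x ∈ Set.range r} ≃ κ := (Equiv.ofInjective r hr).symm
  refine ⟨(Equiv.sumCompl (· ∈ Set.range r)).symm.trans (e₁.sumCongr e₂), fun i => ?_⟩
  rw [Equiv.trans_apply, Equiv.sumCompl_symm_apply_of_pos (p := (· ∈ Set.range r)) ⟨i, rfl⟩,
    Equiv.sumCongr_apply, Sum.map_inl]
  congr 1
  exact Equiv.ofInjective_symm_apply hr i

end Equiv

/-! ### The block normal form of a matrix with an invertible top-left block -/

section NormalForm

variable {R : Type*} [CommRing R] {κ : Type*} [Fintype κ] [DecidableEq κ]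

/-- **Block normal form.**  If the `κ × κ` block `B₁₁` of `B = (B₁₁ B₁₂; B₂₁ B₂₂)` is invertible then
`P B Q = diag(1, B₂₂ - B₂₁ B₁₁⁻¹ B₁₂)` with `P = (B₁₁⁻¹ 0; -B₂₁B₁₁⁻¹ 1)`, `Q = (1 -B₁₁⁻¹B₁₂; 0 1)`,
`det P = det B₁₁⁻¹`, `det Q = 1` (Gaussian elimination by blocks). [folklore] -/
theorem blockNormalForm_eq (B₁₁ : Matrix κ κ R) [Invertible B₁₁] (B₁₂ : Matrix κ (Fin 2) R)
    (B₂₁ : Matrix (Fin 2) κ R) (B₂₂ : Matrix (Fin 2) (Fin 2) R) :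
    Matrix.fromBlocks (⅟B₁₁) 0 (-(B₂₁ * ⅟B₁₁)) 1 * Matrix.fromBlocks B₁₁ B₁₂ B₂₁ B₂₂ *
        Matrix.fromBlocks 1 (-(⅟B₁₁ * B₁₂)) 0 1 =
      Matrix.fromBlocks 1 0 0 (B₂₂ - B₂₁ * ⅟B₁₁ * B₁₂) := by
  rw [Matrix.fromBlocks_multiply, Matrix.fromBlocks_multiply]
  simp only [Matrix.zero_mul, Matrix.mul_zero, add_zero, Matrix.one_mul, Matrix.mul_one,
    invOf_mul_self, Matrix.neg_mul, Matrix.invOf_mul_cancel_right, neg_add_cancel, Matrix.mul_neg,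
    neg_add_eq_sub, sub_zero]

/-- Determinants of the two elimination matrices. [folklore] -/
theorem det_blockNormalForm_left (B₁₁ : Matrix κ κ R) [Invertible B₁₁] (B₂₁ : Matrix (Fin 2) κ R) :
    (Matrix.fromBlocks (⅟B₁₁) 0 (-(B₂₁ * ⅟B₁₁)) (1 : Matrix (Fin 2) (Fin 2) R)).det = (⅟B₁₁).det := by
  rw [Matrix.det_fromBlocks_zero₁₂, Matrix.det_one, mul_one]

/-- Determinants of the two elimination matrices. [folklore] -/
theorem det_blockNormalForm_right (B₁₁ : Matrix κ κ R) [Invertible B₁₁] (B₁₂ : Matrix κ (Fin 2) R) :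
    (Matrix.fromBlocks (1 : Matrix κ κ R) (-(⅟B₁₁ * B₁₂)) 0 (1 : Matrix (Fin 2) (Fin 2) R)).det = 1 := by
  rw [Matrix.det_fromBlocks_zero₂₁, Matrix.det_one, Matrix.det_one, mul_one]

end NormalForm

/-! ### Determinant of a two-sided reindexing -/

section Reindex

variable {ι ι' : Type*} [Fintype ι] [DecidableEq ι] [Fintype ι'] [DecidableEq ι'] {T : Type*} [CommRing T]

/-- `det (reindex e₁ e₂ M) = sign(e₂⁻¹ e₁) · det M`. [folklore] -/
theorem det_reindex_eq_sign_mul (e₁ e₂ : ι ≃ ι') (M : Matrix ι ι T) :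
    (Matrix.reindex e₁ e₂ M).det = ((Equiv.Perm.sign (e₂.symm.trans e₁) : ℤ) : T) * M.det := by
  have h : Matrix.reindex e₁ e₂ M = (Matrix.reindex e₁ e₁ M).submatrix id ⇑(e₂.symm.trans e₁) := by
    ext i j
    simp only [Matrix.reindex_apply, Matrix.submatrix_apply, id, Equiv.trans_apply,
      Equiv.symm_apply_apply]
  rw [h, Matrix.det_permute', Matrix.det_reindex_self]

end Reindex

/-! ### The local Hessian bound at points with a unit `(n-2)`-minor -/

section Main

variable {ι κ σ : Type*} [Fintype ι] [DecidableEq ι] [Fintype κ] [DecidableEq κ] [Fintype σ]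
  [DecidableEq σ] {R : Type*} [CommRing R] [Algebra ℂ R] [Module.Finite ℂ R]

/-- **Local Hessian bound at residual corank at most two, every coefficient algebra.**  Let `R` be a
finite-dimensional commutative `ℂ`-algebra, `λ : R → ℂ` linear, `A` a square matrix of affine forms over
`R` (index type `ι`) with read-out `F = λ(det A)`, and `p` a point with `det A(p) = 0` in `R` such that
some `(|ι| - 2) × (|ι| - 2)` minor of the value matrix `A(p)` (rows `r`, columns `c`) is a UNIT of `R`.
Then `rank Hess F(p) ≤ 2 · dim_ℂ R · |ι|`.  Proof: Gaussian elimination by blocks over `R` brings `A(p)`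
to `diag(1, S)` with `S ∈ Mat₂(R)`, `det S = 0` (`blockNormalForm_eq`); the elimination matrices are
constants, so they transport the affine matrix, the functional (by the unit `± det P`) and the Hessian, and
`rank_hess0_transl_le_of_blockNormalForm` applies.  For a local `R` this covers exactly the points of
residual corank `≤ 2`. [cite: MignonRessayre2004, §2] -/
theorem rank_hess0_transl_le_of_isUnit_minor (l : R →ₗ[ℂ] ℂ) (A : Matrix ι ι (MvPolynomial σ R))
    (F : MvPolynomial σ ℂ) (hA : ∀ a b, (A a b).totalDegree ≤ 1)
    (hF : ∀ d, l (coeff d A.det) = coeff d F) (p : σ → ℂ)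
    (hp : eval (fun i => algebraMap ℂ R (p i)) A.det = 0) (r c : κ → ι)
    (hu : IsUnit ((A.map (eval fun i => algebraMap ℂ R (p i))).submatrix r c).det)
    (hcard : Fintype.card ι = Fintype.card κ + 2) :
    (hess0 (transl p F)).rank ≤ 2 * Module.finrank ℂ R * Fintype.card ι := by
  classical
  set x : σ → R := fun i => algebraMap ℂ R (p i) with hx
  set B : Matrix ι ι R := A.map (eval x) with hB
  rcases subsingleton_or_nontrivial R with hR | hR
  · have hF0 : F = 0 := by
      ext d
      rw [← hF d, Subsingleton.elim (coeff d A.det) 0, map_zero, coeff_zero]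
    rw [hF0, map_zero, map_zero, Matrix.rank_zero]
    exact Nat.zero_le _
  -- the rows `r` and columns `c` are injective
  have hr : Function.Injective r := by
    intro i j hij
    by_contra hne
    have h0 : (B.submatrix r c).det = 0 :=
      Matrix.det_zero_of_row_eq hne (funext fun k => by simp only [Matrix.submatrix_apply, hij])
    exact not_isUnit_zero (h0 ▸ hu)
  have hc : Function.Injective c := by
    intro i j hij
    by_contra hne
    have h0 : (B.submatrix r c).det = 0 :=
      Matrix.det_zero_of_column_eq hne (fun k => by simp only [Matrix.submatrix_apply, hij])
    exact not_isUnit_zero (h0 ▸ hu)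
  obtain ⟨eR, heR⟩ := exists_equiv_sum_fin_two r hr hcard
  obtain ⟨eC, heC⟩ := exists_equiv_sum_fin_two c hc hcard
  have hsR : ∀ i, eR.symm (Sum.inl i) = r i := fun i => by
    rw [Equiv.symm_apply_eq]; exact (heR i).symm
  have hsC : ∀ i, eC.symm (Sum.inl i) = c i := fun i => by
    rw [Equiv.symm_apply_eq]; exact (heC i).symm
  -- the reindexed value matrix and its invertible corner
  set B' : Matrix (κ ⊕ Fin 2) (κ ⊕ Fin 2) R := Matrix.reindex eR eC B with hB'
  have h11 : B'.toBlocks₁₁ = B.submatrix r c := by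
    ext i j
    simp only [hB', Matrix.toBlocks₁₁, Matrix.of_apply, Matrix.reindex_apply, Matrix.submatrix_apply,
      hsR, hsC]
  letI : Invertible B'.toBlocks₁₁ := Matrix.invertibleOfIsUnitDet _ (by rw [h11]; exact hu)
  set P : Matrix (κ ⊕ Fin 2) (κ ⊕ Fin 2) R :=
    Matrix.fromBlocks (⅟B'.toBlocks₁₁) 0 (-(B'.toBlocks₂₁ * ⅟B'.toBlocks₁₁)) 1 with hP
  set Q : Matrix (κ ⊕ Fin 2) (κ ⊕ Fin 2) R :=
    Matrix.fromBlocks 1 (-(⅟B'.toBlocks₁₁ * B'.toBlocks₁₂)) 0 1 with hQ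
  set S : Matrix (Fin 2) (Fin 2) R :=
    B'.toBlocks₂₂ - B'.toBlocks₂₁ * ⅟B'.toBlocks₁₁ * B'.toBlocks₁₂ with hSdef
  have hPBQ : P * B' * Q = Matrix.fromBlocks 1 0 0 S := by
    have h := blockNormalForm_eq B'.toBlocks₁₁ B'.toBlocks₁₂ B'.toBlocks₂₁ B'.toBlocks₂₂
    rwa [Matrix.fromBlocks_toBlocks] at h
  have hPdet : P.det = (⅟B'.toBlocks₁₁).det := det_blockNormalForm_left _ _
  have hQdet : Q.det = 1 := det_blockNormalForm_right _ _
  -- the transported affine matrix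
  set A' : Matrix (κ ⊕ Fin 2) (κ ⊕ Fin 2) (MvPolynomial σ R) :=
    P.map C * Matrix.reindex eR eC A * Q.map C with hA'def
  have hA'aff : ∀ a b, (A' a b).totalDegree ≤ 1 := by
    intro a b
    rw [hA'def, Matrix.mul_apply]
    refine totalDegree_finsetSum_le fun k _ => ?_
    refine (totalDegree_mul _ _).trans ?_
    rw [Matrix.map_apply, totalDegree_C, add_zero, Matrix.mul_apply]
    refine totalDegree_finsetSum_le fun j _ => ?_
    refine (totalDegree_mul _ _).trans ?_
    rw [Matrix.map_apply, totalDegree_C, zero_add, Matrix.reindex_apply, Matrix.submatrix_apply]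
    exact hA _ _
  have hCev : ∀ N : Matrix (κ ⊕ Fin 2) (κ ⊕ Fin 2) R,
      (N.map (C : R → MvPolynomial σ R)).map (eval x) = N := fun N => by
    ext i j
    simp only [Matrix.map_apply, eval_C]
  have hA'val : A'.map (eval x) = Matrix.fromBlocks 1 0 0 S := by
    rw [hA'def, Matrix.map_mul, Matrix.map_mul, hCev, hCev, ← hPBQ, hB']
    rfl
  -- determinant bookkeeping: `det A' = C u · det A` with `u` a unit
  set ρ : Equiv.Perm (κ ⊕ Fin 2) := eC.symm.trans eR with hρ
  set u : R := ((Equiv.Perm.sign ρ : ℤ) : R) * P.det with hudef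
  have hunit : IsUnit u := by
    refine IsUnit.mul ?_ ?_
    · rcases Int.units_eq_one_or (Equiv.Perm.sign ρ) with h | h <;> simp [h]
    · rw [hPdet]
      exact Matrix.isUnit_det_of_invertible _
  have hdetA' : A'.det = C u * A.det := by
    rw [hA'def, Matrix.det_mul, Matrix.det_mul, det_reindex_eq_sign_mul,
      ← RingHom.mapMatrix_apply, ← RingHom.map_det, ← RingHom.mapMatrix_apply, ← RingHom.map_det,
      hQdet, map_one, mul_one, hudef, map_mul, map_intCast]
    ring
  obtain ⟨w, hw⟩ := hunit
  -- the transported functional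
  set l' : R →ₗ[ℂ] ℂ := l ∘ₗ LinearMap.mulLeft ℂ (↑w⁻¹ : R) with hl'
  have hF' : ∀ d, l' (coeff d A'.det) = coeff d F := by
    intro d
    rw [hl', LinearMap.comp_apply, LinearMap.mulLeft_apply, hdetA', coeff_C_mul, ← hw, ← mul_assoc,
      Units.inv_mul, one_mul, hF]
  -- `det S = 0`
  have hBdet : B.det = 0 := by
    rw [hB, ← RingHom.mapMatrix_apply, ← RingHom.map_det, hp]
  have hS : S.det = 0 := by
    have h1 : (P * B' * Q).det = 0 := by
      rw [Matrix.det_mul, Matrix.det_mul, hB', det_reindex_eq_sign_mul, hBdet, mul_zero, mul_zero,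
        zero_mul]
    rwa [hPBQ, Matrix.det_fromBlocks_zero₂₁, Matrix.det_one, one_mul] at h1
  -- conclude at the block normal form
  have h := rank_hess0_transl_le_of_blockNormalForm l' A' F hA'aff hF' p S hA'val hS
  rw [hcard]
  exact h

/-- **Residual form.**  With a character `φ` of nilpotent kernel (a local `R` with residue field `ℂ`):
if `det A(p) = 0` in `R` and some `(n-2) × (n-2)` minor of the residual value matrix `φ(A(p))` is
non-zero — i.e. `A(p) mod 𝔪` has corank at most two — then `rank Hess F(p) ≤ 2 · dim R · n`.
[cite: MignonRessayre2004, §2] -/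
theorem rank_hess0_transl_le_of_residual_minor_ne_zero (φ : R →ₐ[ℂ] ℂ) {ν : ℕ}
    (hker : RingHom.ker (φ : R →+* ℂ) ^ ν = ⊥) (l : R →ₗ[ℂ] ℂ) (A : Matrix ι ι (MvPolynomial σ R))
    (F : MvPolynomial σ ℂ) (hA : ∀ a b, (A a b).totalDegree ≤ 1)
    (hF : ∀ d, l (coeff d A.det) = coeff d F) (p : σ → ℂ)
    (hp : eval (fun i => algebraMap ℂ R (p i)) A.det = 0) (r c : κ → ι)
    (hres : φ ((A.map (eval fun i => algebraMap ℂ R (p i))).submatrix r c).det ≠ 0)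
    (hcard : Fintype.card ι = Fintype.card κ + 2) :
    (hess0 (transl p F)).rank ≤ 2 * Module.finrank ℂ R * Fintype.card ι :=
  rank_hess0_transl_le_of_isUnit_minor l A F hA hF p hp r c (isUnit_of_apply_ne_zero φ hker hres) hcard

end Main

end Summit.ValiantsHypothesis.ValiantsHypothesis.Theorems.GrenetZeonPolySizeQPAlgebra

end
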